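import Summits.QuantumAdvantage.AdviceFreeQNC0.UnionBoundLift
import Mathlib.LinearAlgebra.Dimension.Constructions
import Mathlib.LinearAlgebra.LinearIndependent.Lemmas
import HarnessLib

/-!
# Cell qa-qnc0 (rung F-Q1, route RingFrame, crux α, line `tensor`): the RANK FORM of the union bound
# (qn-p2 ROUND-3 §2(c), ask P2-3) — `#D₀ ≤ (3r + 2)·w`

Planner qa-qnc0-p2's ROUND-3 §2(c): for the leader matrix `a = X ⊕ Y` (rows `a_x`, all of weight
`≤ w`) put `Φ(x,y) := a_x + a_y + a_{x⊕y} ∈ 𝔽₂^V` and `r := dim_{𝔽₂} span{Φ(x,y)}`; then the union of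
the leaders `D₀ = ⋃_x supp a_x` (`colDiff X Y`) has **`#D₀ ≤ 3w·r + 2w ≤ (3r+2)·w`**.  Typed here in the
general shape the argument actually proves — for ANY Boolean matrix `a` on `{0,1}^L × {0,1}^{L'}` with
row weights `≤ w`, no radius hypothesis and no Reed–Muller structure:

* `card_colSupp_le_rankForm`: `#(⋃_x supp a_x) ≤ 3·w·r + 2·w`, `r = cobRank a` (`finrank` of the span
  `cobSpan a` of the coboundaries `cob a (x,y)`).  Proof: (i) a basis of the span can be taken among
  the `Φ(x,y)`, each of weight `≤ 3w`, so `U := supp(span) ` has `#U ≤ 3wr`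
  (`card_cobSupp_le`); (ii) off `U` every `Φ(x,y)` vanishes, so `x ↦ a_x(v)` is ADDITIVE and the
  point class `S_v = {x : a_x(v) = 1}` is empty or has `≥ 2^{L−1}` elements
  (`two_pow_le_two_mul_card_pointClass`: translating by a point of `S_v` maps its complement into it);
  (iii) loads: `Σ_v #S_v = Σ_x |a_x| ≤ 2^L·w` (`sum_card_pointClass_le`), whence `#(D₀ ∖ U) ≤ 2w`.
* `card_colDiff_le_rankForm`: the Sketch3 form `#colDiff X Y ≤ 3·w·cobRank (xorM X Y) + 2·w` under
  `∀ u, rowDist X Y u ≤ w`.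
* `RankBound` — qn-p2's CONJECTURE R (ROUND-3 §2(c): "`∃ r₀ ∀ strictly light W: r(W) ≤ r₀`") typed
  over the Sketch3 vocabulary; `unionBound_of_rankBound` (`K = 3r₀ + 2`) and
  `liftOneStrict_of_rankBound` put the ladder **R ⟹ UB ⟹ STRICT-U** in the kernel
  (`unionBoundSuffices`, `UnionBoundLift.lean`).

WHAT THIS IS NOT: R / UB / STRICT-U are qn-p2's conjectures (kit evidence ROUND-3 §4 only); nothing
here bears on `TRPlus`, `RingToElim`, `RingHard 2` or the rung leaf.
-/

namespace Summit.QuantumAdvantage.AdviceFreeQNC0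

open Finset Module
open Literature.Computability.MetaComplexity Literature.Computability.MetaComplexity.Smolensky

variable {L L' : ℕ}

/-! ### Vocabulary: row weights, the union of supports, coboundaries and their rank -/

/-- weight of row `x` of the Boolean matrix `a`. -/
def rowWt (a : (Fin L → Bool) → (Fin L' → Bool) → Bool) (x : Fin L → Bool) : ℕ :=
  (univ.filter fun v : Fin L' → Bool => a x v = true).card

/-- `⋃_x supp a_x`: the columns meeting some row (for `a = X ⊕ Y` this is `colDiff X Y`). -/
def colSupp (a : (Fin L → Bool) → (Fin L' → Bool) → Bool) : Finset (Fin L' → Bool) :=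
  univ.filter fun v : Fin L' → Bool => ∃ x, a x v = true

/-- row `x` of `a` as a vector of `𝔽₂^{{0,1}^{L'}}`. -/
def rowInd (a : (Fin L → Bool) → (Fin L' → Bool) → Bool) (x : Fin L → Bool) : CubeFn (ZMod 2) L' :=
  fun v => if a x v = true then 1 else 0

/-- coordinatewise XOR of two row indices. -/
def xorRow (x y : Fin L → Bool) : Fin L → Bool := fun i => xor (x i) (y i)

/-- the COBOUNDARY `Φ(x,y) = a_x + a_y + a_{x ⊕ y} ∈ 𝔽₂^{{0,1}^{L'}}` (qn-p2 ROUND-3 §1). -/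
def cob (a : (Fin L → Bool) → (Fin L' → Bool) → Bool) (p : (Fin L → Bool) × (Fin L → Bool)) :
    CubeFn (ZMod 2) L' :=
  rowInd a p.1 + rowInd a p.2 + rowInd a (xorRow p.1 p.2)

/-- `Z = span{Φ(x,y)}`. -/
def cobSpan (a : (Fin L → Bool) → (Fin L' → Bool) → Bool) : Submodule (ZMod 2) (CubeFn (ZMod 2) L') :=
  Submodule.span (ZMod 2) (Set.range (cob a))

/-- `r = dim_{𝔽₂} span{Φ(x,y)}` (qn-p2's rank `r = rank N − L`). -/
noncomputable def cobRank (a : (Fin L → Bool) → (Fin L' → Bool) → Bool) : ℕ :=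
  finrank (ZMod 2) (cobSpan a)

/-- `U = supp Z`: the columns at which some coboundary is non-zero. -/
def cobSupp (a : (Fin L → Bool) → (Fin L' → Bool) → Bool) : Finset (Fin L' → Bool) :=
  univ.filter fun v : Fin L' → Bool => ∃ p, cob a p v ≠ 0

/-- the point class `S_v = {x : v ∈ a_x}`. -/
def pointClass (a : (Fin L → Bool) → (Fin L' → Bool) → Bool) (v : Fin L' → Bool) :
    Finset (Fin L → Bool) :=
  univ.filter fun x : Fin L → Bool => a x v = true

/-! ### (i) the support of the span of the coboundaries -/

/-- The support of one coboundary has at most `|a_x| + |a_y| + |a_{x⊕y}|` points. -/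
theorem card_support_cob_le (a : (Fin L → Bool) → (Fin L' → Bool) → Bool)
    (p : (Fin L → Bool) × (Fin L → Bool)) :
    (univ.filter fun v : Fin L' → Bool => cob a p v ≠ 0).card ≤
      rowWt a p.1 + rowWt a p.2 + rowWt a (xorRow p.1 p.2) := by
  unfold rowWt
  calc (univ.filter fun v : Fin L' → Bool => cob a p v ≠ 0).card
      ≤ (((univ.filter fun v : Fin L' → Bool => a p.1 v = true) ∪
          (univ.filter fun v : Fin L' → Bool => a p.2 v = true)) ∪
          (univ.filter fun v : Fin L' → Bool => a (xorRow p.1 p.2) v = true)).card := by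
        refine Finset.card_le_card fun v hv => ?_
        rw [Finset.mem_filter] at hv
        simp only [Finset.mem_union, Finset.mem_filter, Finset.mem_univ, true_and]
        by_contra hcon
        push Not at hcon
        obtain ⟨⟨h1, h2⟩, h3⟩ := hcon
        apply hv.2
        simp only [cob, rowInd, Pi.add_apply, h1, h2, h3, Bool.false_eq_true, if_false, add_zero]
    _ ≤ ((univ.filter fun v : Fin L' → Bool => a p.1 v = true) ∪
          (univ.filter fun v : Fin L' → Bool => a p.2 v = true)).card +
          (univ.filter fun v : Fin L' → Bool => a (xorRow p.1 p.2) v = true).card :=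
        Finset.card_union_le _ _
    _ ≤ _ := Nat.add_le_add_right (Finset.card_union_le _ _) _

/-- **`#U ≤ 3w·r`**: a basis of `span{Φ}` can be chosen among the coboundaries, each of weight `≤ 3w`,
and every point of `U` lies in the support of a basis vector. -/
theorem card_cobSupp_le (a : (Fin L → Bool) → (Fin L' → Bool) → Bool) {w : ℕ}
    (hw : ∀ x, rowWt a x ≤ w) : (cobSupp a).card ≤ 3 * w * cobRank a := by
  classical
  obtain ⟨b, hbsub, hbspan, hbli⟩ := exists_linearIndependent (ZMod 2) (Set.range (cob a))
  have hbfin : b.Finite := Set.toFinite b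
  set bF : Finset (CubeFn (ZMod 2) L') := hbfin.toFinset with hbF
  have hcoe : (bF : Set (CubeFn (ZMod 2) L')) = b := hbfin.coe_toFinset
  -- the rank is the size of the basis
  have hrank : cobRank a = bF.card := by
    unfold cobRank cobSpan
    rw [← hbspan, ← hcoe]
    refine finrank_span_finset_eq_card ?_
    rw [hcoe]
    exact hbli
  -- every point of U is in the support of some basis vector
  have hU : cobSupp a ⊆ bF.biUnion fun g => univ.filter fun v : Fin L' → Bool => g v ≠ 0 := by
    intro v hv
    unfold cobSupp at hv
    obtain ⟨p, hp⟩ := (Finset.mem_filter.1 hv).2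
    rw [Finset.mem_biUnion]
    by_contra hnone
    push Not at hnone
    have hzero : ∀ g ∈ b, g v = 0 := by
      intro g hg
      have hg' : g ∈ bF := by rw [hbF, Set.Finite.mem_toFinset]; exact hg
      have := hnone g hg'
      rw [Finset.mem_filter] at this
      push Not at this
      exact this (Finset.mem_univ _)
    have hle : Submodule.span (ZMod 2) b ≤ LinearMap.ker (LinearMap.proj v) := by
      rw [Submodule.span_le]
      intro g hg
      rw [SetLike.mem_coe, LinearMap.mem_ker, LinearMap.proj_apply]
      exact hzero g hg
    have hmem : cob a p ∈ Submodule.span (ZMod 2) b := by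
      rw [hbspan]
      exact Submodule.subset_span ⟨p, rfl⟩
    have := hle hmem
    rw [LinearMap.mem_ker, LinearMap.proj_apply] at this
    exact hp this
  -- each basis vector is a coboundary, of weight ≤ 3w
  have hsupp : ∀ g ∈ bF, (univ.filter fun v : Fin L' → Bool => g v ≠ 0).card ≤ 3 * w := by
    intro g hg
    have hg' : g ∈ b := by rw [hbF, Set.Finite.mem_toFinset] at hg; exact hg
    obtain ⟨p, rfl⟩ := hbsub hg'
    calc (univ.filter fun v : Fin L' → Bool => cob a p v ≠ 0).card
        ≤ rowWt a p.1 + rowWt a p.2 + rowWt a (xorRow p.1 p.2) := card_support_cob_le a p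
      _ ≤ w + w + w := Nat.add_le_add (Nat.add_le_add (hw _) (hw _)) (hw _)
      _ = 3 * w := by ring
  calc (cobSupp a).card
      ≤ (bF.biUnion fun g => univ.filter fun v : Fin L' → Bool => g v ≠ 0).card :=
        Finset.card_le_card hU
    _ ≤ ∑ g ∈ bF, (univ.filter fun v : Fin L' → Bool => g v ≠ 0).card := Finset.card_biUnion_le
    _ ≤ ∑ _g ∈ bF, 3 * w := Finset.sum_le_sum hsupp
    _ = 3 * w * cobRank a := by rw [Finset.sum_const, smul_eq_mul, hrank]; ring

/-! ### (ii) off `U` the point classes are empty or large -/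

/-- Off `U` the map `x ↦ a_x(v)` is additive: `a_{x⊕y}(v) = a_x(v) ⊕ a_y(v)`. -/
theorem additive_of_notMem_cobSupp (a : (Fin L → Bool) → (Fin L' → Bool) → Bool)
    {v : Fin L' → Bool} (hv : v ∉ cobSupp a) (x y : Fin L → Bool) :
    a (xorRow x y) v = xor (a x v) (a y v) := by
  have h0 : cob a (x, y) v = 0 := by
    by_contra h
    exact hv (Finset.mem_filter.2 ⟨Finset.mem_univ _, (x, y), h⟩)
  simp only [cob, rowInd, Pi.add_apply] at h0
  have key : ∀ p q s : Bool,
      (if p = true then (1 : ZMod 2) else 0) + (if q = true then (1 : ZMod 2) else 0) +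
        (if s = true then (1 : ZMod 2) else 0) = 0 → s = xor p q := by
    decide
  exact key _ _ _ h0

/-- **Off `U`, a non-empty point class has at least `2^{L−1}` elements**: translation by one of its
points maps its complement injectively into it. -/
theorem two_pow_le_two_mul_card_pointClass (a : (Fin L → Bool) → (Fin L' → Bool) → Bool)
    {v : Fin L' → Bool} (hv : v ∉ cobSupp a) (hne : v ∈ colSupp a) :
    2 ^ L ≤ 2 * (pointClass a v).card := by
  obtain ⟨x₀, hx₀⟩ := (Finset.mem_filter.1 hne).2
  -- the complement maps into the class under x ↦ x ⊕ x₀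
  have hmap : ((univ : Finset (Fin L → Bool)) \ pointClass a v).card ≤ (pointClass a v).card := by
    refine Finset.card_le_card_of_injOn (fun x => xorRow x x₀) (fun x hx => ?_) ?_
    · rw [Finset.mem_coe, Finset.mem_sdiff] at hx
      have hxa : a x v = false := by
        have := hx.2
        unfold pointClass at this
        rw [Finset.mem_filter] at this
        simpa using this
      rw [Finset.mem_coe]
      unfold pointClass
      rw [Finset.mem_filter]
      refine ⟨Finset.mem_univ _, ?_⟩
      rw [additive_of_notMem_cobSupp a hv x x₀, hxa, hx₀]
      decide
    · intro x _ y _ hxy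
      have : ∀ i, x i = y i := fun i => by
        have h := congrFun hxy i
        simp only [xorRow] at h
        have key : ∀ p q s : Bool, xor p s = xor q s → p = q := by decide
        exact key _ _ _ h
      exact funext this
  have htot : ((univ : Finset (Fin L → Bool)) \ pointClass a v).card + (pointClass a v).card = 2 ^ L := by
    rw [Finset.card_sdiff_add_card_eq_card (Finset.subset_univ _), Finset.card_univ, Fintype.card_fun,
      Fintype.card_bool, Fintype.card_fin]
  omega

/-! ### (iii) loads -/

/-- **Loads**: `Σ_v #S_v = Σ_x |a_x| ≤ 2^L·w`. -/
theorem sum_card_pointClass_le (a : (Fin L → Bool) → (Fin L' → Bool) → Bool) {w : ℕ}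
    (hw : ∀ x, rowWt a x ≤ w) : ∑ v, (pointClass a v).card ≤ 2 ^ L * w := by
  have hswap : ∑ v, (pointClass a v).card = ∑ x, rowWt a x := by
    unfold pointClass rowWt
    simp_rw [Finset.card_filter]
    exact Finset.sum_comm
  rw [hswap]
  calc ∑ x, rowWt a x ≤ ∑ _x : Fin L → Bool, w := Finset.sum_le_sum fun x _ => hw x
    _ = 2 ^ L * w := by
        rw [Finset.sum_const, smul_eq_mul, Finset.card_univ, Fintype.card_fun, Fintype.card_bool,
          Fintype.card_fin]

/-- **`#(D₀ ∖ U) ≤ 2w`.** -/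
theorem card_colSupp_sdiff_cobSupp_le (a : (Fin L → Bool) → (Fin L' → Bool) → Bool) {w : ℕ}
    (hw : ∀ x, rowWt a x ≤ w) : (colSupp a \ cobSupp a).card ≤ 2 * w := by
  have h1 : 2 ^ L * (colSupp a \ cobSupp a).card ≤ 2 * ∑ v ∈ colSupp a \ cobSupp a, (pointClass a v).card := by
    rw [Finset.mul_sum, mul_comm, ← smul_eq_mul, ← Finset.sum_const]
    refine Finset.sum_le_sum fun v hv => ?_
    rw [Finset.mem_sdiff] at hv
    exact two_pow_le_two_mul_card_pointClass a hv.2 hv.1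
  have h2 : ∑ v ∈ colSupp a \ cobSupp a, (pointClass a v).card ≤ ∑ v, (pointClass a v).card :=
    Finset.sum_le_sum_of_subset_of_nonneg (Finset.subset_univ _) fun _ _ _ => Nat.zero_le _
  have h3 := sum_card_pointClass_le a hw
  have h4 : 2 ^ L * (colSupp a \ cobSupp a).card ≤ 2 ^ L * (2 * w) := by
    calc 2 ^ L * (colSupp a \ cobSupp a).card ≤ 2 * ∑ v, (pointClass a v).card :=
          h1.trans (Nat.mul_le_mul_left 2 h2)
      _ ≤ 2 * (2 ^ L * w) := Nat.mul_le_mul_left 2 h3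
      _ = 2 ^ L * (2 * w) := by ring
  exact Nat.le_of_mul_le_mul_left h4 (Nat.two_pow_pos L)

/-! ### The rank form -/

/-- **RANK FORM of the union bound** (qn-p2 ROUND-3 §2(c), general shape): for every Boolean matrix
`a` with row weights `≤ w`, `#(⋃_x supp a_x) ≤ 3·w·r + 2·w` where `r = dim span{a_x + a_y + a_{x⊕y}}`. -/
theorem card_colSupp_le_rankForm (a : (Fin L → Bool) → (Fin L' → Bool) → Bool) {w : ℕ}
    (hw : ∀ x, rowWt a x ≤ w) : (colSupp a).card ≤ 3 * w * cobRank a + 2 * w := by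
  calc (colSupp a).card ≤ (cobSupp a ∪ (colSupp a \ cobSupp a)).card :=
        Finset.card_le_card fun v hv => by
          rw [Finset.mem_union, Finset.mem_sdiff]
          by_cases h : v ∈ cobSupp a
          · exact Or.inl h
          · exact Or.inr ⟨hv, h⟩
    _ ≤ (cobSupp a).card + (colSupp a \ cobSupp a).card := Finset.card_union_le _ _
    _ ≤ 3 * w * cobRank a + 2 * w :=
        Nat.add_le_add (card_cobSupp_le a hw) (card_colSupp_sdiff_cobSupp_le a hw)

/-! ### The Sketch3 form and the ladder R ⟹ UB ⟹ STRICT-U -/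

/-- `colDiff X Y` is the union of the supports of the rows of `X ⊕ Y`. -/
theorem colDiff_eq_colSupp_xorM (X Y : (Fin L → Bool) → (Fin L' → Bool) → Bool) :
    colDiff X Y = colSupp (xorM X Y) := by
  unfold colDiff colSupp xorM
  congr 1
  ext v
  simp only [ne_eq]
  constructor
  · rintro ⟨u, hu⟩
    refine ⟨u, ?_⟩
    have key : ∀ p q : Bool, ¬ p = q → xor p q = true := by decide
    exact key _ _ hu
  · rintro ⟨u, hu⟩
    refine ⟨u, ?_⟩
    have key : ∀ p q : Bool, xor p q = true → ¬ p = q := by decide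
    exact key _ _ hu

/-- `rowDist X Y u` is the weight of row `u` of `X ⊕ Y`. -/
theorem rowDist_eq_rowWt_xorM (X Y : (Fin L → Bool) → (Fin L' → Bool) → Bool) (u : Fin L → Bool) :
    rowDist X Y u = rowWt (xorM X Y) u := by
  unfold rowDist rowWt xorM
  congr 1
  ext v
  simp only [Finset.mem_filter, Finset.mem_univ, true_and, ne_eq]
  have key : ∀ p q : Bool, ¬ p = q ↔ xor p q = true := by decide
  exact key _ _

/-- **RANK FORM, Sketch3 shape** (qn-p2 ask P2-3): `#colDiff X Y ≤ 3·w·r + 2·w ≤ (3r + 2)·w` with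
`r = cobRank (xorM X Y)`, for every `X`, `Y` with `rowDist X Y ≤ w` row-wise. -/
theorem card_colDiff_le_rankForm (X Y : (Fin L → Bool) → (Fin L' → Bool) → Bool) {w : ℕ}
    (h : ∀ u, rowDist X Y u ≤ w) :
    (colDiff X Y).card ≤ 3 * w * cobRank (xorM X Y) + 2 * w := by
  rw [colDiff_eq_colSupp_xorM]
  exact card_colSupp_le_rankForm (xorM X Y) fun x => by rw [← rowDist_eq_rowWt_xorM]; exact h x

/-- **CONJECTURE R** (qn-p2 ROUND-3 §2(c): "`∃ r₀ ∀ strictly light W : r(W) ≤ r₀`"), typed over the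
Sketch3 vocabulary: strictly inside the unique-decoding radius the coboundary rank of the leader
matrix of a matrix with linear columns and `w`-light rows is bounded by an absolute constant. OPEN
(qn-p2: verified only at `f = 8`; `r ∈ {3,4}` in every SAT witness at `f ∈ {16,32,64}`, `L ≤ 4`). -/
def RankBound : Prop :=
  ∃ r₀ : ℕ, ∀ L L' d w : ℕ, 2 * w < 2 ^ (L' - d) →
    ∀ X Y : (Fin L → Bool) → (Fin L' → Bool) → Bool, LinCols X → RowsDeg d Y →
      (∀ u, rowDist X Y u ≤ w) → cobRank (xorM X Y) ≤ r₀

/-- **R ⟹ UB** with `K = 3r₀ + 2`. -/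
theorem unionBound_of_rankBound : RankBound → UnionBound := by
  rintro ⟨r₀, hr₀⟩
  refine ⟨3 * r₀ + 2, by positivity, fun L L' d w hrad X Y hX hY hdist => ?_⟩
  have h1 := card_colDiff_le_rankForm X Y hdist
  have h2 := hr₀ L L' d w hrad X Y hX hY hdist
  have h3 : (colDiff X Y).card ≤ (3 * r₀ + 2) * w := by
    calc (colDiff X Y).card ≤ 3 * w * cobRank (xorM X Y) + 2 * w := h1
      _ ≤ 3 * w * r₀ + 2 * w := Nat.add_le_add_right (Nat.mul_le_mul_left _ h2) _
      _ = (3 * r₀ + 2) * w := by ring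
  exact_mod_cast h3

/-- **R ⟹ STRICT-U** (the ladder of qn-p2 ROUND-3 §2(c) in the kernel). -/
theorem liftOneStrict_of_rankBound : RankBound → LiftOneStrict :=
  fun h => unionBoundSuffices (unionBound_of_rankBound h)

end Summit.QuantumAdvantage.AdviceFreeQNC0
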